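import Summits.NavierStokesRegularity.NavierStokesRegularity.Theorems.HeredityAtOne.Negative.CappedSubfloor
import Summits.NavierStokesRegularity.NavierStokesRegularity.Theorems.HeredityAtOne.Negative.NoSwirlCapEighth
import Summits.NavierStokesRegularity.NavierStokesRegularity.Theorems.HeredityAtOne.Negative.ReadoutFloorsAtOneFalseOfCappedStageAtOne
import Summits.NavierStokesRegularity.FluidComputer.PalasekTowerRegisterGlobalFloorsAtSlice
import Literature.Analysis.FluidPDE.NSTaoClassOfSobolevDatum

/-!
# The capped signed swirl-free STRATUM of the `∀`-binder of `HeredityAtOne`: the binder census as theorems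

Cell `ns-blowup`, seat `refuter-ns-palasek-19249-disprove-1` (g2; DISPROVER, route `PalasekTowerBreakdown`, item
stmt-NavierStokesRegularity-19249 `HeredityAtOne`). NEGATIVE-LANE lemmas (no positive Theses conclusion), sorry-free,
NO named fact (the Gallay–Šverák cap enters through the tree theorem `isNoSwirlCapConstant_eighth`, constant
`0.35356 = 1/(2√2)⁺`). Makes the tribunal's T2 r3 supplement ("the `∀`-binder includes axisymmetric-no-swirl hosts
under the GS15 all-time speed cap", 3eec0c4d45769a4d) precise in the kernel:

§1 **The cap in the register's own classical finite-energy rendering.** By the RESTART theorem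
(`IsClassicalNSSolutionOn.exists_norm_le_of_restart_unforced`, Tao 2013 Cor. 11.1 for an `H^∞` datum — no decay of
the slice needed) every finite-energy classical UNFORCED run on any slab from the `τ_k`-slice of ANY stage is
Tao-class, so the cap binds it (`speed_le_noSwirlCap_of_slice`); a signed swirl-free registered slice is in the
ABSTRACT cap class (`windowSpeedCap_slice`) and the two witness classes of record NEST:
`NoSwirlCappedStageAtOne → CappedStageAtOne`.
§2 **A registered signed swirl-free slice at a quiet level `k ≥ 1` makes the whole DESIGN globally regular**
(`exists_global_solution_of_signedNoSwirlSlice`; history before `τ_k` arbitrary — swirling, non-symmetric, forced):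
global classical bounded-energy solution, equal to the stage on `[0, τ_k]`, speed `≤ 0.35356·√(√((∫η)(∫r²η))·M)`
for all `t ≥ τ_k` (KJ-15's Leray–Clay dichotomy fed with §1). On such hosts the tower's purpose is void.
§3 **Per-stub exposure (line `Lines/birth.lean` v3).** The cap bears on EXACTLY ONE of the four registered stubs:
`CappedStageAt k → ¬ SpeedFloorAt k` (unconditional in the witness — the competitor is the design's own global
flow; slice template `not_readoutAt_of_lazy_slice`), at `k = 1` with the number
(`not_speedFloorAt_one_of_signedNoSwirlSlice_eighth`); the upper stub is cap-IMMUNE on such stages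
(`ceiling_of_signedNoSwirlSlice`); the strain and core stubs are cap-blind.
§4 **The stratum split** (def-free here; named `InCapStratum` / `HeredityAtOffStratum` / `CapStratumEmptyAt` in the
companion `CapStratum.lean`): `HeredityAt k ↔ (heredity OFF the capped signed swirl-free stratum) ∧ (the stratum
is EMPTY)` (`k ≥ 1`, lossless, `heredityAt_iff_off_and_empty`) — ON the stratum heredity IS emptiness. At `k = 1`
by the route decl's name (`heredityAtOne_iff_off_and_empty`): item 19249 CONTAINS a Liouville-type
NON-registration conjunct, presently certifiable only in the vacuous regime `¬ EpisodeBaseG`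
(`capStratum_empty_one_of_not_episodeBaseG`). REPAIR LINE (in advance, for the supplement's immunisation (c)):
the minimal repaired `∀`-statement is the OFF-stratum conjunct; every lever of this lane is vacuous against it;
the banked alternative is the `∃`-ladder form (p434821).

WHAT THIS IS NOT: not Navier–Stokes evidence, no verdict change — no stage, design or slice is constructed;
`InCapStratum 1` is EMPTY-IN-PRACTICE (a member is a registered level-1 stage, `EpisodeBaseG`-hard, whose `τ₁`-slice
is a near-extremal signed swirl-free ring: `sup|u|/G ≥ 0.35356/2.2099 = 0.160` of the sharp kinematic `0.2165`;
cell MODEL numerics `μ ≤ 1.17–1.42 ≪ 2.21`). Learning for the proof side: any proof of `SpeedFloorAt 1` must USE a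
property false on capped signed swirl-free slices (swirl / genuine three-dimensionality of the registered slice),
which the register `Margins.routeG` does not name.
References: Gallay–Šverák, Confluentes Math. 7 (2015) = arXiv:1510.01036 [cite: GallaySverak2016, Prop. 2.6];
Tao, Anal. PDE 6 (2013) [cite: Tao2011, Cor. 11.1]; Leray 1934 [cite: Leray1934, §32]; Palasek, arXiv:2605.13827
[cite: Palasek2026ElementaryModel, §4].
-/

noncomputable section

namespace Summit.NavierStokesRegularity.HeredityAtOneNoSwirlStratum

open Set MeasureTheory Filter Topology Function
open scoped ENNReal NNReal ContDiff
open Literature.Analysis.FluidPDE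
open Summit.NavierStokesRegularity.FluidComputer
open Summit.NavierStokesRegularity.FluidComputer.PalasekTowerClayBridge
open Summit.NavierStokesRegularity.NavierStokesRegularity
open Summit.NavierStokesRegularity.HeredityAtOneNoSwirlCap
open Summit.NavierStokesRegularity.HeredityAtOneSpeedCap
open Summit.NavierStokesRegularity.HeredityAtOneStubExposure

/-! ## §1 The Gallay–Šverák cap in the classical finite-energy rendering -/

/-- **The cap binds every finite-energy classical unforced run from an `H^∞` signed swirl-free slice.** If `C`
validates the cap (`IsNoSwirlCapConstant C`), `v` is a velocity family with bounded Sobolev norms of all orders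
on a time set `T₀`, `t₀ ∈ T₀`, and the slice `v t₀` is single-signed swirl-free with height `M`, then every
classical solution `(u, p)` on a slab `[a, b]` of a system whose force VANISHES on the slab, of finite energy
there, with `u a = v t₀`, obeys `‖u(t, x)‖ ≤ C √(√((∫η)(∫r²η)) M)` on `[a, b] × ℝ³` (`η = ω_θ/r` of the slice).
Restart (the run is Tao-class, Tao 2013 Cor. 11.1 for an `H^∞` datum) + the cap on Tao's class.
[cite: GallaySverak2016, Prop. 2.6] [cite: Tao2011, Cor. 11.1] -/
theorem speed_le_noSwirlCap_of_sobolevDatum {C : ℝ} (hC : IsNoSwirlCapConstant C) {T₀ : Set ℝ}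
    {v : ℝ → EuclideanSpace ℝ (Fin 3) → EuclideanSpace ℝ (Fin 3)} (hv : HasBoundedSobolevNormsOn T₀ v)
    {t₀ : ℝ} (ht₀ : t₀ ∈ T₀) {M : ℝ} (hsl : SignedNoSwirlSlice (v t₀) M) ⦃a b : ℝ⦄ (hab : a < b)
    (f u : ℝ → EuclideanSpace ℝ (Fin 3) → EuclideanSpace ℝ (Fin 3))
    (p : ℝ → EuclideanSpace ℝ (Fin 3) → ℝ) (hu : IsClassicalNSSolutionOn (Icc a b) 1 f u p)
    (hf : ∀ t ∈ Icc a b, f t = 0)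
    (hE : ∃ C : ℝ≥0∞, C < ⊤ ∧ ∀ t ∈ Icc a b, ∫⁻ x, ‖u t x‖ₑ ^ 2 ≤ C) (hua : u a = v t₀) :
    ∀ t ∈ Icc a b, ∀ x,
      ‖u t x‖ ≤ C * Real.sqrt (Real.sqrt ((∫ y, angVortQuot (v t₀) y) *
        ∫ y, cylRadius y ^ 2 * angVortQuot (v t₀) y) * M) := by
  have hT : 0 < b - a := sub_pos.2 hab
  -- translate the run to start at time `0`; the force vanishes on the slab
  have hpre : Icc 0 (b - a) ⊆ (fun σ => σ + a) ⁻¹' Icc a b := by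
    intro σ hσ
    simp only [mem_preimage, mem_Icc] at hσ ⊢
    constructor <;> linarith [hσ.1, hσ.2]
  have hcl : IsClassicalNSSolutionOn (Icc 0 (b - a)) 1 0 (fun σ => u (σ + a))
      (fun σ => p (σ + a)) :=
    ((hu.comp_add_right a).mono hpre (uniqueDiffOn_Icc hT)).congr_force fun σ hσ x => by
      have hft : f (σ + a) = 0 := hf _ (hpre hσ)
      simp only [hft, Pi.zero_apply]
  have hE' : ∃ C : ℝ≥0, ∀ σ ∈ Icc 0 (b - a), ∫⁻ x, ‖u (σ + a) x‖ₑ ^ 2 ≤ C := by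
    obtain ⟨C, hC, hb⟩ := hE
    exact ⟨C.toNNReal, fun σ hσ => (hb _ (hpre hσ)).trans (ENNReal.coe_toNNReal hC.ne).ge⟩
  have hu0 : (fun σ => u (σ + a)) 0 = v t₀ := by simp only [zero_add]; exact hua
  -- restart: the run is Tao-class on its closed slab (no spatial decay of the slice is needed)
  have hSob : HasBoundedSobolevNormsOn (Icc 0 (b - a)) (fun σ => u (σ + a)) :=
    (hcl.exists_norm_le_of_restart_unforced hv ht₀ one_pos hT hE' hu0).1
  have hHk : IsHkClassicalSolutionOn (Icc 0 (b - a)) (fun σ => u (σ + a)) (fun σ => p (σ + a)) :=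
    ⟨hcl, fun n => by
      obtain ⟨Cn, hCn⟩ := hSob n
      exact ⟨max 1 Cn, fun σ hσ => eLpNorm_two_le_max_of_lintegral_sq_le (hCn σ hσ)⟩⟩
  obtain ⟨q, hTao⟩ := hHk.exists_isTaoSolutionOn hT
  have hTao' : IsTaoSolutionOn (b - a) 1 (v t₀) (fun σ => u (σ + a)) q := by
    simpa only [zero_add, hua] using hTao
  intro t ht x
  have hb := hC.2 hT hTao' hsl.axisym hsl.noSwirl hsl.nonneg hsl.le hsl.integrable hsl.integrable_sq
    (t - a) ⟨by linarith [ht.1], by linarith [ht.2]⟩ x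
  simpa only [sub_add_cancel] using hb

section Slice

variable {R : TowerRates} {S : Schedule R} {m : Margins R} {k : ℕ}

/-- **The cap binds every finite-energy classical unforced run from a registered signed swirl-free slice**
(any rates, schedule, margins, LEVEL — also `k = 0` — and no quietness: the runs are unforced by hypothesis):
the `τ_k`-slice of a stage has all Sobolev norms finite (`stage_hasBoundedSobolevNormsOn`), so §1 applies.
[cite: GallaySverak2016, Prop. 2.6] [cite: Tao2011, Cor. 11.1] -/
theorem speed_le_noSwirlCap_of_slice {C : ℝ} (hC : IsNoSwirlCapConstant C) (s : Stage 1 R S m k)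
    {M : ℝ} (hsl : SignedNoSwirlSlice (s.u (S.τ k)) M) ⦃a b : ℝ⦄ (hab : a < b)
    (f u : ℝ → EuclideanSpace ℝ (Fin 3) → EuclideanSpace ℝ (Fin 3))
    (p : ℝ → EuclideanSpace ℝ (Fin 3) → ℝ) (hu : IsClassicalNSSolutionOn (Icc a b) 1 f u p)
    (hf : ∀ t ∈ Icc a b, f t = 0)
    (hE : ∃ C : ℝ≥0∞, C < ⊤ ∧ ∀ t ∈ Icc a b, ∫⁻ x, ‖u t x‖ₑ ^ 2 ≤ C) (hua : u a = s.u (S.τ k)) :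
    ∀ t ∈ Icc a b, ∀ x,
      ‖u t x‖ ≤ C * Real.sqrt (Real.sqrt ((∫ y, angVortQuot (s.u (S.τ k)) y) *
        ∫ y, cylRadius y ^ 2 * angVortQuot (s.u (S.τ k)) y) * M) :=
  speed_le_noSwirlCap_of_sobolevDatum hC (stage_hasBoundedSobolevNormsOn s) ⟨(S.τ_pos k).le, le_rfl⟩
    hsl hab f u p hu hf hE hua

/-- **A registered signed swirl-free slice is in the abstract cap class** of
`HeredityAtOneFalseOfCappedStageAtOne`: `WindowSpeedCap {s.u(τ_k)} (const (C·cap value))`.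
[cite: GallaySverak2016, Prop. 2.6] -/
theorem windowSpeedCap_slice {C : ℝ} (hC : IsNoSwirlCapConstant C) (s : Stage 1 R S m k) {M : ℝ}
    (hsl : SignedNoSwirlSlice (s.u (S.τ k)) M) :
    WindowSpeedCap {s.u (S.τ k)} (fun _ =>
      C * Real.sqrt (Real.sqrt ((∫ y, angVortQuot (s.u (S.τ k)) y) *
        ∫ y, cylRadius y ^ 2 * angVortQuot (s.u (S.τ k)) y) * M)) :=
  (windowSpeedCap_singleton_const_iff _ _).2 (speed_le_noSwirlCap_of_slice hC s hsl)

end Slice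

/-! ## §2 Nesting of the witness classes; global regularity of the design -/

/-- **`H_GS(k) ⊆ H_cap(k)`**: a pinned rigid quiet wide design with a registered level-`k` stage whose
`τ_k`-slice is single-signed swirl-free with `C·(cap value) < c₁ Y_{k+1}` (for a cap constant `C`)
inhabits the abstract witness class `CappedStageAt k` (cap class eliminated, `cappedStageAt_iff_exists_speed_bound`).
[cite: GallaySverak2016, Prop. 2.6] [cite: Palasek2026ElementaryModel, §4] -/
theorem cappedStageAt_of_signedNoSwirlSlice {k : ℕ} {C : ℝ} (hC : IsNoSwirlCapConstant C)
    {S : Schedule TowerRates.wide} (hP : S.Pins 8 (6 / 5)) (hR : S.Rigid) (hQ : S.Quiet)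
    (s : Stage 1 TowerRates.wide S (Margins.routeG TowerRates.wide) k) {M : ℝ}
    (hsl : SignedNoSwirlSlice (s.u (S.τ k)) M)
    (hlt : C * Real.sqrt (Real.sqrt ((∫ y, angVortQuot (s.u (S.τ k)) y) *
        ∫ y, cylRadius y ^ 2 * angVortQuot (s.u (S.τ k)) y) * M) <
      S.c₁ * TowerRates.wide.Y (k + 1)) :
    CappedStageAt k :=
  (cappedStageAt_iff_exists_speed_bound k).2
    ⟨S, s, _, hP, hR, hQ, hlt, speed_le_noSwirlCap_of_slice hC s hsl⟩

/-- **The two witness classes of record NEST**: `NoSwirlCappedStageAtOne → CappedStageAtOne` (the discharged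
Gallay–Šverák class is a sub-class of the abstract cap class; both remain uninhabited in the tree).
[cite: GallaySverak2016, Prop. 2.6] [cite: Palasek2026ElementaryModel, §4] -/
theorem cappedStageAtOne_of_noSwirlCappedStageAtOne (h : NoSwirlCappedStageAtOne) : CappedStageAtOne := by
  obtain ⟨C, hC, S, s, M, hP, hR, hQ, hsl, hlt⟩ := h
  exact cappedStageAt_of_signedNoSwirlSlice hC hP hR hQ s hsl hlt

/-- … hence it also inhabits the SUB-FLOOR trigger `SubfloorStageAt k` (`k ≥ 1`; KJ-15
`subfloorStageAt_of_cappedStageAt`). [cite: Palasek2026ElementaryModel, §4] [cite: Leray1934, §32] -/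
theorem subfloorStageAt_of_signedNoSwirlSlice {k : ℕ} (hk : 1 ≤ k) {C : ℝ} (hC : IsNoSwirlCapConstant C)
    {S : Schedule TowerRates.wide} (hP : S.Pins 8 (6 / 5)) (hR : S.Rigid) (hQ : S.Quiet)
    (s : Stage 1 TowerRates.wide S (Margins.routeG TowerRates.wide) k) {M : ℝ}
    (hsl : SignedNoSwirlSlice (s.u (S.τ k)) M)
    (hlt : C * Real.sqrt (Real.sqrt ((∫ y, angVortQuot (s.u (S.τ k)) y) *
        ∫ y, cylRadius y ^ 2 * angVortQuot (s.u (S.τ k)) y) * M) <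
      S.c₁ * TowerRates.wide.Y (k + 1)) :
    SubfloorStageAt k :=
  subfloorStageAt_of_cappedStageAt hk (cappedStageAt_of_signedNoSwirlSlice hC hP hR hQ s hsl hlt)

/-- **A REGISTERED SIGNED SWIRL-FREE SLICE AT A QUIET LEVEL `k ≥ 1` MAKES THE DESIGN GLOBALLY REGULAR.**
For a quiet wide design `S` and a registered level-`k` stage `s` (`k ≥ 1`) whose `τ_k`-slice is single-signed
swirl-free with height `M` — the history before `τ_k` being arbitrary (swirling, non-symmetric, forced) — the
Clay data `(S.u₀, S.f)` launch a GLOBAL classical solution with bounded energy, equal to the stage on `[0, τ_k]`,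
with speed `≤ C √(√((∫η)(∫r²η)) M)` at all times `t ≥ τ_k`, for every cap constant `C`. NO smallness of the cap
value is needed. (Leray–Clay dichotomy of KJ-15, `exists_global_solution_of_speed_bound`, fed with §1.)
[cite: GallaySverak2016, Thm. 1.1 + Prop. 2.6] [cite: Leray1934, §32] -/
theorem exists_global_solution_of_signedNoSwirlSlice {k : ℕ} (hk : 1 ≤ k) {C : ℝ}
    (hC : IsNoSwirlCapConstant C) {S : Schedule TowerRates.wide} (hQ : S.Quiet)
    (s : Stage 1 TowerRates.wide S (Margins.routeG TowerRates.wide) k) {M : ℝ}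
    (hsl : SignedNoSwirlSlice (s.u (S.τ k)) M) :
    ∃ (U : ℝ → EuclideanSpace ℝ (Fin 3) → EuclideanSpace ℝ (Fin 3))
      (P : ℝ → EuclideanSpace ℝ (Fin 3) → ℝ),
      IsClassicalNSSolutionOn (Ici 0) 1 S.f U P ∧ U 0 = S.u₀ ∧ HasBoundedEnergy U ∧
      (∀ t ∈ Icc 0 (S.τ k), U t = s.u t) ∧
      ∀ t, S.τ k ≤ t → ∀ x,
        ‖U t x‖ ≤ C * Real.sqrt (Real.sqrt ((∫ y, angVortQuot (s.u (S.τ k)) y) *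
          ∫ y, cylRadius y ^ 2 * angVortQuot (s.u (S.τ k)) y) * M) :=
  exists_global_solution_of_speed_bound hk s hQ (speed_le_noSwirlCap_of_slice hC s hsl)

/-- The same with the NUMBER `0.35356` and no cap-constant hypothesis (`isNoSwirlCapConstant_eighth`).
[cite: GallaySverak2016, Thm. 1.1 + Prop. 2.6 (2.14)] [cite: Leray1934, §32] -/
theorem exists_global_solution_of_signedNoSwirlSlice_eighth {k : ℕ} (hk : 1 ≤ k)
    {S : Schedule TowerRates.wide} (hQ : S.Quiet)
    (s : Stage 1 TowerRates.wide S (Margins.routeG TowerRates.wide) k) {M : ℝ}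
    (hsl : SignedNoSwirlSlice (s.u (S.τ k)) M) :
    ∃ (U : ℝ → EuclideanSpace ℝ (Fin 3) → EuclideanSpace ℝ (Fin 3))
      (P : ℝ → EuclideanSpace ℝ (Fin 3) → ℝ),
      IsClassicalNSSolutionOn (Ici 0) 1 S.f U P ∧ U 0 = S.u₀ ∧ HasBoundedEnergy U ∧
      (∀ t ∈ Icc 0 (S.τ k), U t = s.u t) ∧
      ∀ t, S.τ k ≤ t → ∀ x,
        ‖U t x‖ ≤ 0.35356 * Real.sqrt (Real.sqrt ((∫ y, angVortQuot (s.u (S.τ k)) y) *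
          ∫ y, cylRadius y ^ 2 * angVortQuot (s.u (S.τ k)) y) * M) :=
  exists_global_solution_of_signedNoSwirlSlice hk isNoSwirlCapConstant_eighth hQ s hsl

/-! ## §3 Per-stub exposure of the line `Lines/birth.lean` v3 -/

/-- **The cap class kills the SPEED stub, unconditionally in the witness**: `CappedStageAt k → ¬ SpeedFloorAt k`
(`k ≥ 1`): the design's own global flow (KJ-15) translated to a free run from the slice is finite-energy, inside
the ceiling (`B < c₁ Y_{k+1} ≤ c₂ Y_{k+1}`) and lazy at `τ_{k+1}` everywhere (`not_readoutAt_of_lazy_slice`); no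
`AprioriCeilingAt`/envelope hypothesis. [cite: Palasek2026ElementaryModel, §4] [cite: Leray1934, §32] -/
theorem not_speedFloorAt_of_cappedStageAt {k : ℕ} (hk : 1 ≤ k) (hW : CappedStageAt k) :
    ¬ SpeedFloorAt k := by
  obtain ⟨S, s, B, hP, hR, hQ, hBlt, hcap⟩ := (cappedStageAt_iff_exists_speed_bound k).1 hW
  obtain ⟨u, p, hcl, -, hE, hagree, hbd⟩ := exists_classical_continuation_of_speed_bound hk s hQ hcap
  have hY : 0 < TowerRates.wide.Y (k + 1) := Real.rpow_pos_of_pos (TowerRates.wide.N_pos (k + 1)) _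
  have hB2 : B ≤ S.c₂ * TowerRates.wide.Y (k + 1) :=
    hBlt.le.trans (mul_le_mul_of_nonneg_right s.c₁_le_c₂ hY.le)
  unfold SpeedFloorAt
  refine not_readoutAt_of_lazy_slice hk ⟨S, s, fun σ => u (σ + S.τ k), fun σ => p (σ + S.τ k),
    hP, hR, hQ, Stage.freeRun_of_continuation hQ hk s hcl, ?_, ?_, ?_, ?_⟩
  · simp only [zero_add]
    exact hagree _ ⟨(S.τ_pos k).le, le_rfl⟩
  · obtain ⟨C, hC, hCE⟩ := hE
    exact ⟨C, hC, fun σ hσ => hCE _ ⟨by linarith [hσ.1, S.τ_pos k], by linarith [hσ.2]⟩⟩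
  · intro σ hσ x
    exact (hbd _ ⟨by linarith [hσ.1], by linarith [hσ.2]⟩ x).trans hB2
  · rintro ⟨x, -, hx⟩
    simp only [sub_add_cancel] at hx
    linarith [hbd (S.τ (k + 1)) ⟨(S.τ_lt_succ k).le, le_rfl⟩ x]

/-- The first rung by name: `CappedStageAtOne → ¬ SpeedFloorAt 1` — the registered stub
`stub_speed_floor_at_one` of item 19249 is the ONE conjunct the abstract cap lever bears on.
[cite: Palasek2026ElementaryModel, §4] -/
theorem not_speedFloorAt_one_of_cappedStageAtOne (hW : CappedStageAtOne) : ¬ SpeedFloorAt 1 :=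
  not_speedFloorAt_of_cappedStageAt le_rfl hW

/-- **The no-swirl cap kills the speed stub**: a cap constant `C`, a pinned rigid quiet wide design, ONE
registered level-`k` stage (`k ≥ 1`) with single-signed swirl-free `τ_k`-slice and `C·(cap value) < c₁ Y_{k+1}`
refute `SpeedFloorAt k`. [cite: GallaySverak2016, Prop. 2.6] [cite: Palasek2026ElementaryModel, §4] -/
theorem not_speedFloorAt_of_signedNoSwirlSlice {k : ℕ} (hk : 1 ≤ k) {C : ℝ} (hC : IsNoSwirlCapConstant C)
    {S : Schedule TowerRates.wide} (hP : S.Pins 8 (6 / 5)) (hR : S.Rigid) (hQ : S.Quiet)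
    (s : Stage 1 TowerRates.wide S (Margins.routeG TowerRates.wide) k) {M : ℝ}
    (hsl : SignedNoSwirlSlice (s.u (S.τ k)) M)
    (hlt : C * Real.sqrt (Real.sqrt ((∫ y, angVortQuot (s.u (S.τ k)) y) *
        ∫ y, cylRadius y ^ 2 * angVortQuot (s.u (S.τ k)) y) * M) <
      S.c₁ * TowerRates.wide.Y (k + 1)) :
    ¬ SpeedFloorAt k :=
  not_speedFloorAt_of_cappedStageAt hk (cappedStageAt_of_signedNoSwirlSlice hC hP hR hQ s hsl hlt)

/-- **Item 19249's speed stub with the number `0.35356`** (no named fact): ONE registered LEVEL-1 stage of a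
pinned rigid quiet wide design whose `τ₁`-slice is single-signed swirl-free with
`0.35356 · √(√((∫η)(∫r²η)) · M) < c₁ Y₂` refutes `SpeedFloorAt 1` (= `stub_speed_floor_at_one`). Premise
empty-in-practice. [cite: GallaySverak2016, Prop. 2.6 (2.14)] [cite: Palasek2026ElementaryModel, §4] -/
theorem not_speedFloorAt_one_of_signedNoSwirlSlice_eighth {S : Schedule TowerRates.wide}
    (hP : S.Pins 8 (6 / 5)) (hR : S.Rigid) (hQ : S.Quiet)
    (s : Stage 1 TowerRates.wide S (Margins.routeG TowerRates.wide) 1) {M : ℝ}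
    (hsl : SignedNoSwirlSlice (s.u (S.τ 1)) M)
    (hlt : 0.35356 * Real.sqrt (Real.sqrt ((∫ y, angVortQuot (s.u (S.τ 1)) y) *
        ∫ y, cylRadius y ^ 2 * angVortQuot (s.u (S.τ 1)) y) * M) <
      S.c₁ * TowerRates.wide.Y 2) :
    ¬ SpeedFloorAt 1 :=
  not_speedFloorAt_of_signedNoSwirlSlice le_rfl isNoSwirlCapConstant_eighth hP hR hQ s hsl hlt

/-- **Cap-immunity of the UPPER stub on such stages**: for a quiet wide design, `k ≥ 1`, a stage whose
`τ_k`-slice is single-signed swirl-free with `C·(cap value) < c₁ Y_{k+1}`, EVERY finite-energy classical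
continuation `(u, p)` of the stage (design force) on any `[0, T']` stays `≤ c₂ Y_{k+1}` on `[0, T'] × ℝ³` — the
`AprioriCeilingAt k` instance of the stage holds (`ceiling_of_windowSpeedCap_lt` on the class of §1).
[cite: GallaySverak2016, Prop. 2.6] -/
theorem ceiling_of_signedNoSwirlSlice {k : ℕ} (hk : 1 ≤ k) {C : ℝ} (hC : IsNoSwirlCapConstant C)
    {S : Schedule TowerRates.wide} {m : Margins TowerRates.wide} (hQ : S.Quiet)
    (s : Stage 1 TowerRates.wide S m k) {M : ℝ} (hsl : SignedNoSwirlSlice (s.u (S.τ k)) M)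
    (hlt : C * Real.sqrt (Real.sqrt ((∫ y, angVortQuot (s.u (S.τ k)) y) *
        ∫ y, cylRadius y ^ 2 * angVortQuot (s.u (S.τ k)) y) * M) <
      S.c₁ * TowerRates.wide.Y (k + 1)) {T' : ℝ}
    {u : ℝ → EuclideanSpace ℝ (Fin 3) → EuclideanSpace ℝ (Fin 3)}
    {p : ℝ → EuclideanSpace ℝ (Fin 3) → ℝ} (hu : IsClassicalNSSolutionOn (Icc 0 T') 1 S.f u p)
    (hus : ∀ t ∈ Icc 0 (S.τ k), u t = s.u t ∧ p t = s.p t)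
    (hE : ∃ C : ℝ≥0∞, C < ⊤ ∧ ∀ t ∈ Icc 0 T', ∫⁻ x, ‖u t x‖ₑ ^ 2 ≤ C) :
    ∀ t ∈ Icc 0 T', ∀ x, ‖u t x‖ ≤ S.c₂ * TowerRates.wide.Y (k + 1) :=
  ceiling_of_windowSpeedCap_lt (windowSpeedCap_slice hC s hsl) hQ hk s (Set.mem_singleton _) hlt hu hus hE

/-! ## §4 The stratum split, def-free form (named predicates in the companion `CapStratum.lean`)

ON the capped signed swirl-free stratum — registered level-`k` stages whose `τ_k`-slice is single-signed
swirl-free with `0.35356·(cap value) < c₁ Y_{k+1}` — heredity IS emptiness; OFF it, it is the hand-over claim. -/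

/-- **THE STRATUM SPLIT (lossless, def-free)**: for `k ≥ 1`, `HeredityAt k` iff (i) every registered level-`k`
stage of a pinned rigid quiet wide design whose `τ_k`-slice is NOT a capped signed swirl-free slice extends to
level `k + 1`, AND (ii) NO registered level-`k` stage of such a design has a capped signed swirl-free `τ_k`-slice
(a Liouville-type NON-registration claim). [cite: GallaySverak2016, Prop. 2.6 (2.14)] [cite: Palasek2026ElementaryModel, §4] -/
theorem heredityAt_iff_off_and_empty {k : ℕ} (hk : 1 ≤ k) :
    HeredityAt k ↔
      (∀ S : Schedule TowerRates.wide, S.Pins 8 (6 / 5) → S.Rigid → S.Quiet →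
        ∀ s : Stage 1 TowerRates.wide S (Margins.routeG TowerRates.wide) k,
          (¬ ∃ M : ℝ, SignedNoSwirlSlice (s.u (S.τ k)) M ∧
            0.35356 * Real.sqrt (Real.sqrt ((∫ y, angVortQuot (s.u (S.τ k)) y) *
                ∫ y, cylRadius y ^ 2 * angVortQuot (s.u (S.τ k)) y) * M) <
              S.c₁ * TowerRates.wide.Y (k + 1)) →
          ∃ s' : Stage 1 TowerRates.wide S (Margins.routeG TowerRates.wide) (k + 1), s.Extends s') ∧
      (∀ S : Schedule TowerRates.wide, S.Pins 8 (6 / 5) → S.Rigid → S.Quiet →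
        ∀ s : Stage 1 TowerRates.wide S (Margins.routeG TowerRates.wide) k,
          ¬ ∃ M : ℝ, SignedNoSwirlSlice (s.u (S.τ k)) M ∧
            0.35356 * Real.sqrt (Real.sqrt ((∫ y, angVortQuot (s.u (S.τ k)) y) *
                ∫ y, cylRadius y ^ 2 * angVortQuot (s.u (S.τ k)) y) * M) <
              S.c₁ * TowerRates.wide.Y (k + 1)) :=
  ⟨fun h => ⟨fun S hP hR hQ s _ => h S hP hR hQ s, fun _ hP hR hQ s ⟨_, hsl, hlt⟩ =>
      not_heredityAt_of_signedNoSwirlSlice_eighth hk hP hR hQ s hsl hlt h⟩,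
    fun h S hP hR hQ s => h.1 S hP hR hQ s (h.2 S hP hR hQ s)⟩

/-- **Item 19249 by the route decl's name**: `PalasekTowerBreakdown.HeredityAtOne` iff (heredity OFF the capped
signed swirl-free stratum at level 1) AND (the stratum is EMPTY at level 1: no pinned rigid quiet wide design
registers a level-1 stage whose `τ₁`-slice is a capped signed swirl-free, vortex-ring-type state). The second
conjunct is an `EpisodeBaseG|𝒮`-type claim. [cite: GallaySverak2016, Prop. 2.6 (2.14)] [cite: Palasek2026ElementaryModel, §4] -/
theorem heredityAtOne_iff_off_and_empty :
    Theses.PalasekTowerBreakdown.HeredityAtOne ↔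
      (∀ S : Schedule TowerRates.wide, S.Pins 8 (6 / 5) → S.Rigid → S.Quiet →
        ∀ s : Stage 1 TowerRates.wide S (Margins.routeG TowerRates.wide) 1,
          (¬ ∃ M : ℝ, SignedNoSwirlSlice (s.u (S.τ 1)) M ∧
            0.35356 * Real.sqrt (Real.sqrt ((∫ y, angVortQuot (s.u (S.τ 1)) y) *
                ∫ y, cylRadius y ^ 2 * angVortQuot (s.u (S.τ 1)) y) * M) <
              S.c₁ * TowerRates.wide.Y (1 + 1)) →
          ∃ s' : Stage 1 TowerRates.wide S (Margins.routeG TowerRates.wide) (1 + 1), s.Extends s') ∧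
      (∀ S : Schedule TowerRates.wide, S.Pins 8 (6 / 5) → S.Rigid → S.Quiet →
        ∀ s : Stage 1 TowerRates.wide S (Margins.routeG TowerRates.wide) 1,
          ¬ ∃ M : ℝ, SignedNoSwirlSlice (s.u (S.τ 1)) M ∧
            0.35356 * Real.sqrt (Real.sqrt ((∫ y, angVortQuot (s.u (S.τ 1)) y) *
                ∫ y, cylRadius y ^ 2 * angVortQuot (s.u (S.τ 1)) y) * M) <
              S.c₁ * TowerRates.wide.Y (1 + 1)) :=
  heredityAtOne_iff.trans (heredityAt_iff_off_and_empty le_rfl)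

/-- **The emptiness conjunct is presently certifiable only in the vacuous regime**: if NO pinned rigid quiet
wide design registers a level-1 stage at all (`¬ EpisodeBaseG`, item 19179 open) the stratum is empty at level 1.
[cite: Palasek2026ElementaryModel, §4] -/
theorem capStratum_empty_one_of_not_episodeBaseG (h : ¬ EpisodeBaseG) :
    ∀ S : Schedule TowerRates.wide, S.Pins 8 (6 / 5) → S.Rigid → S.Quiet →
      ∀ s : Stage 1 TowerRates.wide S (Margins.routeG TowerRates.wide) 1,
        ¬ ∃ M : ℝ, SignedNoSwirlSlice (s.u (S.τ 1)) M ∧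
          0.35356 * Real.sqrt (Real.sqrt ((∫ y, angVortQuot (s.u (S.τ 1)) y) *
              ∫ y, cylRadius y ^ 2 * angVortQuot (s.u (S.τ 1)) y) * M) <
            S.c₁ * TowerRates.wide.Y (1 + 1) :=
  fun S hP hR hQ s _ => h ⟨S, hP, hR, hQ, ⟨s⟩⟩

/-- **On the stratum the SPEED stub, too, is emptiness**: `SpeedFloorAt k` (`k ≥ 1`) forbids every registered
level-`k` stage of a pinned rigid quiet wide design to have a capped signed swirl-free `τ_k`-slice.
[cite: GallaySverak2016, Prop. 2.6 (2.14)] [cite: Palasek2026ElementaryModel, §4] -/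
theorem capStratum_empty_of_speedFloorAt {k : ℕ} (hk : 1 ≤ k) (h : SpeedFloorAt k) :
    ∀ S : Schedule TowerRates.wide, S.Pins 8 (6 / 5) → S.Rigid → S.Quiet →
      ∀ s : Stage 1 TowerRates.wide S (Margins.routeG TowerRates.wide) k,
        ¬ ∃ M : ℝ, SignedNoSwirlSlice (s.u (S.τ k)) M ∧
          0.35356 * Real.sqrt (Real.sqrt ((∫ y, angVortQuot (s.u (S.τ k)) y) *
              ∫ y, cylRadius y ^ 2 * angVortQuot (s.u (S.τ k)) y) * M) <
            S.c₁ * TowerRates.wide.Y (k + 1) :=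
  fun _ hP hR hQ s ⟨_, hsl, hlt⟩ =>
    not_speedFloorAt_of_signedNoSwirlSlice hk isNoSwirlCapConstant_eighth hP hR hQ s hsl hlt h

end Summit.NavierStokesRegularity.HeredityAtOneNoSwirlStratum

end
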